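import Summits.CriticalPhenomena.PercolationContinuityZ3.Theorems.PercNearOneGluingNoHeavyQuantIndepBlobGateRaise
import Summits.CriticalPhenomena.PercolationContinuityZ3.Theorems.PercNearOneGluingNoHeavyQuantIndepBlobThinning
import HarnessLib

/-!
# QUANT lane R8, blob lemma (U): the pair raise, and (U) with at most two sub-half gates

builds on p205010 (kernel theorem, internal audit signed; external expert review pending)

Support file (`--supports stmt-CriticalPhenomena-4575`), QUANT lane seat prim-quant-census-1 (gen 12); memo
`run/shared/lean/prim/quant/prim-quant-census-1/U-REDUCTIONS-G12.md` §2 (reduction R2, case k = 2).  Theorems only; no sorries; standard axioms.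

Setting of `…QuantIndepBlobGateRaise`.  When two blobs `x₀ ≠ x₁` carry the SAME gate `t`, the tail `T(t) = P(y ≤ W)` (other gates fixed) is
`t²A₁₁ + t(1−t)(A₁₀ + A₀₁) + (1−t)²A₀₀` with conditional tails `A_{··} ∈ [0,1]` over the remaining blobs, and
`(T(t) − t)/(t(1−t)) = ((1−t)/t)·A₀₀ + (A₁₀ + A₀₁ − 1) + (t/(1−t))·(A₁₁ − 1)` is non-increasing in `t`.  Hence a lower bound
`θ ≤ T(θ)` after raising the common gate to `θ ≥ t` gives `t ≤ T(t)` (the PAIR RAISE; for one blob this is `gate_raise`).  With the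
half-world row this proves (U) whenever at most two blobs have gate `< 1/2`.

* `tail_eq_two_gate_affine` — the four-term conditioning identity on two blobs (powerset form).
* `pair_raise` — `θ(1−θ)·(T(t) − t) ≥ t(1−t)·(T(θ) − θ)` for `t ≤ θ`, gates in `[0,1]`.
* `tail_ge_gate_of_two_below_half` — **(U) when every blob other than `y₀, y₁` has gate `≥ 1/2`** (`p y₀ ≤ p y₁ ≤ 1/2`, `y ≥ 3`,
  `2y − 3 < EW` ⟹ `p y₀ ≤ P(y ≤ W)`): K3-raise `y₀` to `p y₁`, pair-raise both to `1/2`, half-world row.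
[this work]
-/

namespace Summit.CriticalPhenomena.PercolationContinuityZ3.Theorems

namespace Quant

namespace IndepBlob

open Finset

variable {κ : Type*} [Fintype κ] [DecidableEq κ]

/-- The tail conditioned on two blobs `x₀ ≠ x₁` (powerset form): with `R = univ ∖ {x₀, x₁}`, its product weight `w_R` and
`A(c) = Σ_{t ⊆ R : y ≤ c + a(t)} w_R(t)`,
`P_p(y ≤ W) = p x₀ p x₁ A(a x₀ + a x₁) + p x₀ (1 − p x₁) A(a x₀) + (1 − p x₀) p x₁ A(a x₁) + (1 − p x₀)(1 − p x₁) A(0)`. [folklore] -/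
theorem tail_eq_two_gate_affine (p : κ → ℝ) (a : κ → ℕ) {x₀ x₁ : κ} (hx : x₀ ≠ x₁) (y : ℕ) :
    ∑ s ∈ (Finset.univ : Finset (Finset κ)).filter (fun s => y ≤ ∑ k ∈ s, a k), (∏ k, if k ∈ s then p k else 1 - p k) =
      p x₀ * p x₁ * ∑ t ∈ (((Finset.univ.erase x₀).erase x₁).powerset).filter (fun t => y ≤ a x₀ + a x₁ + ∑ k ∈ t, a k),
          (∏ k ∈ (Finset.univ.erase x₀).erase x₁, if k ∈ t then p k else 1 - p k) +
      p x₀ * (1 - p x₁) * ∑ t ∈ (((Finset.univ.erase x₀).erase x₁).powerset).filter (fun t => y ≤ a x₀ + ∑ k ∈ t, a k),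
          (∏ k ∈ (Finset.univ.erase x₀).erase x₁, if k ∈ t then p k else 1 - p k) +
      (1 - p x₀) * p x₁ * ∑ t ∈ (((Finset.univ.erase x₀).erase x₁).powerset).filter (fun t => y ≤ a x₁ + ∑ k ∈ t, a k),
          (∏ k ∈ (Finset.univ.erase x₀).erase x₁, if k ∈ t then p k else 1 - p k) +
      (1 - p x₀) * (1 - p x₁) * ∑ t ∈ (((Finset.univ.erase x₀).erase x₁).powerset).filter (fun t => y ≤ ∑ k ∈ t, a k),
          (∏ k ∈ (Finset.univ.erase x₀).erase x₁, if k ∈ t then p k else 1 - p k) := by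
  have hx₁ : x₁ ∈ Finset.univ.erase x₀ := Finset.mem_erase.2 ⟨hx.symm, Finset.mem_univ _⟩
  rw [tail_eq_gate_affine p a x₀ y]
  -- split each conditional tail on `x₁`
  have hsplit : ∀ c : ℕ, ∑ t ∈ ((Finset.univ.erase x₀).powerset).filter (fun t => y ≤ c + ∑ k ∈ t, a k),
      (∏ k ∈ Finset.univ.erase x₀, if k ∈ t then p k else 1 - p k) =
      p x₁ * ∑ t ∈ (((Finset.univ.erase x₀).erase x₁).powerset).filter (fun t => y ≤ c + a x₁ + ∑ k ∈ t, a k),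
          (∏ k ∈ (Finset.univ.erase x₀).erase x₁, if k ∈ t then p k else 1 - p k) +
        (1 - p x₁) * ∑ t ∈ (((Finset.univ.erase x₀).erase x₁).powerset).filter (fun t => y ≤ c + ∑ k ∈ t, a k),
          (∏ k ∈ (Finset.univ.erase x₀).erase x₁, if k ∈ t then p k else 1 - p k) := by
    intro c
    have h := sum_weight_powerset_split p (Finset.univ.erase x₀) hx₁ (fun s => if y ≤ c + ∑ k ∈ s, a k then (1 : ℝ) else 0)
    rw [Finset.sum_filter, Finset.sum_filter, Finset.sum_filter]
    have e1 : ∀ s : Finset κ, (if y ≤ c + ∑ k ∈ s, a k then (∏ k ∈ Finset.univ.erase x₀, if k ∈ s then p k else 1 - p k) else 0) =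
        (∏ k ∈ Finset.univ.erase x₀, if k ∈ s then p k else 1 - p k) * (if y ≤ c + ∑ k ∈ s, a k then (1 : ℝ) else 0) := fun s => by
      split_ifs <;> simp
    rw [Finset.sum_congr rfl fun s _ => e1 s, h]
    congr 1
    · congr 1
      refine Finset.sum_congr rfl fun t ht => ?_
      have hx1t : x₁ ∉ t := fun hh => Finset.notMem_erase x₁ _ (Finset.mem_powerset.1 ht hh)
      rw [Finset.sum_insert hx1t, ← add_assoc]
      split_ifs <;> simp
    · congr 1
      refine Finset.sum_congr rfl fun t _ => ?_
      split_ifs <;> simp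
  have h0 := hsplit 0
  have hA := hsplit (a x₀)
  simp only [zero_add] at h0
  rw [hA, h0]
  ring

/-- Weights on the powerset of `univ ∖ {x₀, x₁}` are nonnegative when `0 ≤ p k ≤ 1`. [this work] -/
theorem eraseEraseWeight_nonneg {p : κ → ℝ} (hp0 : ∀ k, 0 ≤ p k) (hp1 : ∀ k, p k ≤ 1) (x₀ x₁ : κ) (t : Finset κ) :
    0 ≤ ∏ k ∈ (Finset.univ.erase x₀).erase x₁, (if k ∈ t then p k else 1 - p k) := by
  refine Finset.prod_nonneg fun k _ => ?_
  split_ifs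
  · exact hp0 k
  · linarith [hp1 k]

/-- A conditional tail over `univ ∖ {x₀, x₁}` is at most `1`. [this work] -/
theorem eraseEraseTail_le_one {p : κ → ℝ} (hp0 : ∀ k, 0 ≤ p k) (hp1 : ∀ k, p k ≤ 1) (x₀ x₁ : κ) (P : Finset κ → Prop)
    [DecidablePred P] :
    ∑ t ∈ (((Finset.univ.erase x₀).erase x₁).powerset).filter P,
        (∏ k ∈ (Finset.univ.erase x₀).erase x₁, if k ∈ t then p k else 1 - p k) ≤ 1 := by
  calc ∑ t ∈ (((Finset.univ.erase x₀).erase x₁).powerset).filter P,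
        (∏ k ∈ (Finset.univ.erase x₀).erase x₁, if k ∈ t then p k else 1 - p k)
      ≤ ∑ t ∈ ((Finset.univ.erase x₀).erase x₁).powerset,
        (∏ k ∈ (Finset.univ.erase x₀).erase x₁, if k ∈ t then p k else 1 - p k) :=
        Finset.sum_le_sum_of_subset_of_nonneg (Finset.filter_subset _ _) fun t _ _ => eraseEraseWeight_nonneg hp0 hp1 x₀ x₁ t
    _ = ∏ k ∈ (Finset.univ.erase x₀).erase x₁, (p k + (1 - p k)) := sum_powerset_prod_ite_mem _ _ _
    _ = 1 := by simp

/-- **The pair raise.**  Gates `0 ≤ p k ≤ 1`; two blobs `x₀ ≠ x₁`; reals `0 ≤ t ≤ θ ≤ 1`.  Writing `T(u)` for the tail `P(y ≤ W)` with the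
gates of `x₀` and `x₁` both set to `u` (other gates those of `p`):  `θ(1−θ)·(T(t) − t) ≥ t(1−t)·(T(θ) − θ)`.
(The difference is `(θ − t)·[(1−θ)(1−t)·A₀₀ + θ t·(1 − A₁₁)] ≥ 0`.)  So `θ ≤ T(θ)` with `0 < θ < 1` forces `t ≤ T(t)`. [this work] -/
theorem pair_raise (p : κ → ℝ) (a : κ → ℕ) (hp0 : ∀ k, 0 ≤ p k) (hp1 : ∀ k, p k ≤ 1) {x₀ x₁ : κ} (hx : x₀ ≠ x₁)
    (t θ : ℝ) (ht0 : 0 ≤ t) (htθ : t ≤ θ) (hθ1 : θ ≤ 1) (y : ℕ) :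
    t * (1 - t) * (∑ s ∈ (Finset.univ : Finset (Finset κ)).filter (fun s => y ≤ ∑ k ∈ s, a k),
        (∏ k, if k ∈ s then Function.update (Function.update p x₀ θ) x₁ θ k
          else 1 - Function.update (Function.update p x₀ θ) x₁ θ k) - θ) ≤
      θ * (1 - θ) * (∑ s ∈ (Finset.univ : Finset (Finset κ)).filter (fun s => y ≤ ∑ k ∈ s, a k),
        (∏ k, if k ∈ s then Function.update (Function.update p x₀ t) x₁ t k
          else 1 - Function.update (Function.update p x₀ t) x₁ t k) - t) := by
  set pθ : κ → ℝ := Function.update (Function.update p x₀ θ) x₁ θ with hpθ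
  set pt : κ → ℝ := Function.update (Function.update p x₀ t) x₁ t with hpt
  have hθ0 : pθ x₀ = θ := by rw [hpθ, Function.update_of_ne hx, Function.update_self]
  have hθ1' : pθ x₁ = θ := by rw [hpθ, Function.update_self]
  have ht0' : pt x₀ = t := by rw [hpt, Function.update_of_ne hx, Function.update_self]
  have ht1' : pt x₁ = t := by rw [hpt, Function.update_self]
  -- the conditional weights over `univ ∖ {x₀, x₁}` agree with those of `p`
  have hwθ : ∀ s : Finset κ, (∏ k ∈ (Finset.univ.erase x₀).erase x₁, if k ∈ s then pθ k else 1 - pθ k) =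
      ∏ k ∈ (Finset.univ.erase x₀).erase x₁, (if k ∈ s then p k else 1 - p k) := by
    intro s
    refine Finset.prod_congr rfl fun k hk => ?_
    have hk1 : k ≠ x₁ := (Finset.mem_erase.1 hk).1
    have hk0 : k ≠ x₀ := (Finset.mem_erase.1 (Finset.mem_erase.1 hk).2).1
    rw [hpθ, Function.update_of_ne hk1, Function.update_of_ne hk0]
  have hwt : ∀ s : Finset κ, (∏ k ∈ (Finset.univ.erase x₀).erase x₁, if k ∈ s then pt k else 1 - pt k) =
      ∏ k ∈ (Finset.univ.erase x₀).erase x₁, (if k ∈ s then p k else 1 - p k) := by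
    intro s
    refine Finset.prod_congr rfl fun k hk => ?_
    have hk1 : k ≠ x₁ := (Finset.mem_erase.1 hk).1
    have hk0 : k ≠ x₀ := (Finset.mem_erase.1 (Finset.mem_erase.1 hk).2).1
    rw [hpt, Function.update_of_ne hk1, Function.update_of_ne hk0]
  rw [tail_eq_two_gate_affine pθ a hx y, tail_eq_two_gate_affine pt a hx y, hθ0, hθ1', ht0', ht1']
  simp_rw [hwθ, hwt]
  set A11 : ℝ := ∑ t ∈ (((Finset.univ.erase x₀).erase x₁).powerset).filter (fun t => y ≤ a x₀ + a x₁ + ∑ k ∈ t, a k),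
      (∏ k ∈ (Finset.univ.erase x₀).erase x₁, if k ∈ t then p k else 1 - p k) with hA11
  set A10 : ℝ := ∑ t ∈ (((Finset.univ.erase x₀).erase x₁).powerset).filter (fun t => y ≤ a x₀ + ∑ k ∈ t, a k),
      (∏ k ∈ (Finset.univ.erase x₀).erase x₁, if k ∈ t then p k else 1 - p k) with hA10
  set A01 : ℝ := ∑ t ∈ (((Finset.univ.erase x₀).erase x₁).powerset).filter (fun t => y ≤ a x₁ + ∑ k ∈ t, a k),
      (∏ k ∈ (Finset.univ.erase x₀).erase x₁, if k ∈ t then p k else 1 - p k) with hA01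
  set A00 : ℝ := ∑ t ∈ (((Finset.univ.erase x₀).erase x₁).powerset).filter (fun t => y ≤ ∑ k ∈ t, a k),
      (∏ k ∈ (Finset.univ.erase x₀).erase x₁, if k ∈ t then p k else 1 - p k) with hA00
  have hA00 : 0 ≤ A00 := Finset.sum_nonneg fun t _ => eraseEraseWeight_nonneg hp0 hp1 x₀ x₁ t
  have hA11 : A11 ≤ 1 := eraseEraseTail_le_one hp0 hp1 x₀ x₁ _
  -- the key identity
  have key : θ * (1 - θ) * (t * t * A11 + t * (1 - t) * A10 + (1 - t) * t * A01 + (1 - t) * (1 - t) * A00 - t) -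
      t * (1 - t) * (θ * θ * A11 + θ * (1 - θ) * A10 + (1 - θ) * θ * A01 + (1 - θ) * (1 - θ) * A00 - θ) =
      (θ - t) * ((1 - θ) * (1 - t) * A00 + θ * t * (1 - A11)) := by ring
  have hprod : 0 ≤ (θ - t) * ((1 - θ) * (1 - t) * A00 + θ * t * (1 - A11)) := by
    apply mul_nonneg (by linarith)
    have h1 : 0 ≤ (1 - θ) * (1 - t) * A00 := by
      apply mul_nonneg (mul_nonneg (by linarith) (by linarith)) hA00
    have h2 : 0 ≤ θ * t * (1 - A11) := by
      apply mul_nonneg (mul_nonneg (by linarith) ht0) (by linarith)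
    linarith
  nlinarith [key, hprod]

/-- **(U) when every blob other than `y₀, y₁` has gate `≥ 1/2`.**  Gates `0 ≤ p k ≤ 1`; blobs `y₀ ≠ y₁` with `p y₀ ≤ p y₁ ≤ 1/2`
and `1/2 ≤ p k` for all other `k`; a level `y ≥ 3` with `2y − 3 < EW`.  Then `p y₀ ≤ P(y ≤ W)`.
Proof: raise `p y₀` to `p y₁` (`gate_raise`), then both to `1/2` (`pair_raise`), then the half-world row. [this work] -/
theorem tail_ge_gate_of_two_below_half (p : κ → ℝ) (a : κ → ℕ) (hp0 : ∀ k, 0 ≤ p k) (hp1 : ∀ k, p k ≤ 1)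
    {y₀ y₁ : κ} (hy01 : y₀ ≠ y₁) (h01 : p y₀ ≤ p y₁) (hhalf : p y₁ ≤ 1 / 2)
    (hothers : ∀ k, k ≠ y₀ → k ≠ y₁ → (1 : ℝ) / 2 ≤ p k)
    (y : ℕ) (hy : 3 ≤ y) (hEW : 2 * (y : ℝ) - 3 < ∑ k, (a k : ℝ) * p k) :
    p y₀ ≤ ∑ s ∈ (Finset.univ : Finset (Finset κ)).filter (fun s => y ≤ ∑ k ∈ s, a k), (∏ k, if k ∈ s then p k else 1 - p k) := by
  set t : ℝ := p y₁ with ht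
  -- step 1: raise `y₀` to `t`
  set p1 : κ → ℝ := Function.update p y₀ t with hp1def
  have hK := gate_raise p a hp0 hp1 y₀ t h01 y
  rw [← hp1def] at hK
  -- trivial case `t = 0`
  by_cases ht0 : t = 0
  · have : p y₀ = 0 := le_antisymm (by rw [← ht0]; exact h01) (hp0 y₀)
    rw [this]
    exact Finset.sum_nonneg fun s _ => bernoulliWeight_nonneg hp0 hp1 s
  have htpos : 0 < t := lt_of_le_of_ne (hp0 y₁) (Ne.symm ht0)
  -- step 2: in `p1` both gates equal `t`; raise both to `1/2`
  have hp10 : ∀ k, 0 ≤ p1 k := by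
    intro k; by_cases hk : k = y₀
    · subst hk; rw [hp1def, Function.update_self]; exact hp0 y₁
    · rw [hp1def, Function.update_of_ne hk]; exact hp0 k
  have hp11 : ∀ k, p1 k ≤ 1 := by
    intro k; by_cases hk : k = y₀
    · subst hk; rw [hp1def, Function.update_self]; exact hp1 y₁
    · rw [hp1def, Function.update_of_ne hk]; exact hp1 k
  have hpt : Function.update (Function.update p1 y₀ t) y₁ t = p1 := by
    funext k
    by_cases hk1 : k = y₁
    · subst hk1; rw [Function.update_self, hp1def, Function.update_of_ne (Ne.symm hy01)]
    · rw [Function.update_of_ne hk1]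
      by_cases hk0 : k = y₀
      · subst hk0; rw [Function.update_self, hp1def, Function.update_self]
      · rw [Function.update_of_ne hk0]
  set p2 : κ → ℝ := Function.update (Function.update p1 y₀ (1 / 2)) y₁ (1 / 2) with hp2
  have hp2half : ∀ k, (1 : ℝ) / 2 ≤ p2 k := by
    intro k
    by_cases hk1 : k = y₁
    · subst hk1; rw [hp2, Function.update_self]
    · rw [hp2, Function.update_of_ne hk1]
      by_cases hk0 : k = y₀
      · subst hk0; rw [Function.update_self]
      · rw [Function.update_of_ne hk0, hp1def, Function.update_of_ne hk0]; exact hothers k hk0 hk1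
  have hp21 : ∀ k, p2 k ≤ 1 := by
    intro k
    by_cases hk1 : k = y₁
    · subst hk1; rw [hp2, Function.update_self]; norm_num
    · rw [hp2, Function.update_of_ne hk1]
      by_cases hk0 : k = y₀
      · subst hk0; rw [Function.update_self]; norm_num
      · rw [Function.update_of_ne hk0]; exact hp11 k
  have hpp2 : ∀ k, p k ≤ p2 k := by
    intro k
    by_cases hk1 : k = y₁
    · subst hk1; rw [hp2, Function.update_self]; exact hhalf
    · rw [hp2, Function.update_of_ne hk1]
      by_cases hk0 : k = y₀
      · subst hk0; rw [Function.update_self]; exact h01.trans hhalf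
      · rw [Function.update_of_ne hk0, hp1def, Function.update_of_ne hk0]
  have hEW2 : 2 * (y : ℝ) - 3 < ∑ k, (a k : ℝ) * p2 k := by
    refine lt_of_lt_of_le hEW (Finset.sum_le_sum fun k _ => ?_)
    exact mul_le_mul_of_nonneg_left (hpp2 k) (by positivity)
  have hA := half_le_tail_of_half_le_gates p2 a hp2half hp21 y hy hEW2
  have hP := pair_raise p1 a hp10 hp11 hy01 t (1 / 2) (le_of_lt htpos) hhalf (by norm_num) y
  rw [hpt, ← hp2] at hP
  set T2 : ℝ := ∑ s ∈ (Finset.univ : Finset (Finset κ)).filter (fun s => y ≤ ∑ k ∈ s, a k),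
      (∏ k, if k ∈ s then p2 k else 1 - p2 k) with hT2
  set T1 : ℝ := ∑ s ∈ (Finset.univ : Finset (Finset κ)).filter (fun s => y ≤ ∑ k ∈ s, a k),
      (∏ k, if k ∈ s then p1 k else 1 - p1 k) with hT1
  -- from `hA`: `T2 − 1/2 ≥ 0`, so `t(1−t)(T2 − 1/2) ≥ 0`, so `(1/2)(1/2)(T1 − t) ≥ 0`, so `T1 ≥ t`
  have h1t : 0 < 1 - t := by linarith
  have h3 : 0 ≤ t * (1 - t) * (T2 - 1 / 2) := mul_nonneg (le_of_lt (mul_pos htpos h1t)) (by linarith [hA])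
  have h4 : 0 ≤ 1 / 2 * (1 - 1 / 2) * (T1 - t) := le_trans h3 hP
  have hT1t : t ≤ T1 := by
    by_contra hneg
    push Not at hneg
    have hq : (0 : ℝ) < 1 / 2 * (1 - 1 / 2) := by norm_num
    have := mul_neg_of_pos_of_neg hq (show T1 - t < 0 by linarith)
    linarith
  -- step 1 conclusion: `p y₀ · T1 ≤ t · P_p`, with `T1 ≥ t > 0`
  have hfin : t * p y₀ ≤ t * ∑ s ∈ (Finset.univ : Finset (Finset κ)).filter (fun s => y ≤ ∑ k ∈ s, a k),
      (∏ k, if k ∈ s then p k else 1 - p k) := by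
    calc t * p y₀ = p y₀ * t := mul_comm _ _
      _ ≤ p y₀ * T1 := mul_le_mul_of_nonneg_left hT1t (hp0 y₀)
      _ ≤ _ := hK
  exact le_of_mul_le_mul_left hfin htpos

end IndepBlob

end Quant

end Summit.CriticalPhenomena.PercolationContinuityZ3.Theorems
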